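import Literature.AnabelianGeometry.EtaleTheta.Discharge.Sec2Prop22iiiOfCoverData
import Literature.AnabelianGeometry.EtaleTheta.Discharge.ZModRankTwoKernel
import Mathlib.Tactic.Group

/-!
# [EtTh] Proposition 2.2 (i) over the BARE interface `CoverData`, from the two inversion hypotheses
# at THE inversion only (proof-only companion; `CoverDataAx.pow_mem_barKer` is idle)

Mochizuki, *The Étale Theta Function …* [EtTh], Publ. RIMS **45** (2009), §2, Prop. 2.2 (i), PRIMS
printed p. 263 (= PDF p. 37; kurims-ms p. 34); bib key `MochizukiEtTh2009`.
PROOF-ONLY companion (no `def`, no new named fact, nothing restated) of `ThetaCovers.lean` (abc-iut-L2-t2,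
p405102), third of the bare-interface series `Sec2Prop22iiOfCoverData` (p431949) / `Sec2Prop22iiiOfCoverData`
(p432525). Cell abc-iut, block C / W6 (seat abc-iut-w6-d082), node `EtTh:Prop2.2(i)`, FACT-LIST row F-0596.

State of record: `CoverData.Prop22_i` is DISCHARGED over `CoverDataAx` (`CoverDataAx.prop22_i_holds`,
`Sec2InversionProofs.lean`, abc-iut-L2-t10), whose proof invokes all three supplementary axioms; its universal
closure over the bare `CoverData` is FALSE (a central inversion has no `(−1)`-eigenspace; abc-iut-w6-d083,
F-0596). This file locates EXACTLY what (i) needs: for a given datum `(Π_C̲ = H', ι̲)` the eigenspace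
exists and is unique as soon as THIS `ι̲` acts by `−1` on `Δ̄^ell_X̲` (`hell : ∀ d ∈ Δ_X̲, ι̲ d ι̲⁻¹ d ∈ Δ̄_Θ-preimage`)
and by `+1` on `Δ̄_Θ` (`htheta : ∀ t ∈ Δ̄_Θ-preimage, [ι̲, t] ∈ Ker`) — print: "eigenvalues `−1` and `1`". The
third axiom `pow_mem_barKer` ("`Δ̄_X` has exponent `l`") is NOT needed: abc-iut-L2-t10's proof uses it only
at elements of the `Δ̄_Θ`-preimage, where `[Δ̄_Θ-preimage : Ker] = l` supplies it
(`CoverData.pow_mem_barKer_of_mem_barTheta`, p432525).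

* `CoverData.exists_generator_mod_barTheta`, `CoverData.comm_of_mem` — `Δ_X̲` is cyclic modulo the
  `Δ̄_Θ`-preimage and abelian modulo `Ker`, over the bare interface (abc-iut-L2-t10's Steps 1–2 verbatim;
  they never used the supplementary axioms);
* `CoverData.existsUnique_isMinusEigen_of_inversion` — Prop 2.2 (i) for ONE datum from `hell`, `htheta`
  at that datum;
* `CoverData.prop22_i_of_inv` — hence `X.Prop22_i` from the two axioms `inv_ell`, `inv_theta` alone
  (`CoverDataAx.prop22_i_holds` is the special case; `pow_mem_barKer` idle).

Nothing here asserts that `CoverData` is inhabited by an actual curve; no side is taken on [IUTchIII]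
Cor. 3.12; typed ≠ proved elsewhere.
-/

namespace Literature.AnabelianGeometry.EtaleTheta.ThetaCovers.CoverData

universe u

variable {l : ℕ} (X : CoverData.{u} l)

/-! ## Step 1: `Δ_X̲` is cyclic modulo `Δ̄_Θ` (bare interface) -/

/-- For `Π_X̲` of type `(1, l-tors)`, `Δ_X̲ = Π_X̲ ∩ Δ_X` is cyclic modulo the inverse image of `Δ̄_Θ`, over
the bare interface: there is `g ∈ Δ_X̲` with `Δ_X̲ = ⋃ₖ gᵏ · (Δ̄_Θ-preimage)` ("`Δ̄^ell_X̲` … is a cyclic group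
of order `l`": the kernel of a surjection `(ℤ/l)² ↠ ℤ/l` is cyclic, `zmod_ker_cyclic`).
[cite: MochizukiEtTh2009, Prop 2.2(ii) p.37] -/
theorem exists_generator_mod_barTheta {H : Subgroup X.PiC} (hT : X.IsTypeLTors H) :
    ∃ g : X.PiC, g ∈ H ∧ g ∈ X.DeltaX ∧
      ∀ d, d ∈ H → d ∈ X.DeltaX → ∃ (k : ℤ) (t : X.PiC), t ∈ X.barTheta ∧ d = g ^ k * t := by
  classical
  haveI := X.PiX_normal
  haveI := X.barTheta_normal
  haveI : X.DeltaX.Normal := inferInstance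
  haveI : (X.barTheta.subgroupOf X.DeltaX).Normal := X.barTheta_normal.subgroupOf _
  obtain ⟨e⟩ := X.ell_rank_two
  obtain ⟨φ, hφs, hφk⟩ := hT.quot
  let incl : X.DeltaX →* X.PiX := Subgroup.inclusion inf_le_left
  have hker : X.barTheta.subgroupOf X.DeltaX ≤ (φ.comp incl).ker := by
    intro t ht
    rw [Subgroup.mem_subgroupOf] at ht
    rw [MonoidHom.mem_ker, MonoidHom.comp_apply, hφk]
    exact hT.barTheta_le ht
  let ψ : X.DeltaX ⧸ X.barTheta.subgroupOf X.DeltaX →* Multiplicative (ZMod l) :=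
    QuotientGroup.lift _ (φ.comp incl) hker
  have hψ : ∀ d : X.DeltaX, ψ (QuotientGroup.mk d) = φ ⟨d, d.2.1⟩ := fun d => rfl
  let F : ZMod l × ZMod l →+ ZMod l :=
    AddMonoidHom.mk' (fun x => Multiplicative.toAdd (ψ (e.symm (Multiplicative.ofAdd x))))
      (fun x y => by simp [ofAdd_add, map_mul, toAdd_mul])
  have hF : ∀ x, F x = Multiplicative.toAdd (ψ (e.symm (Multiplicative.ofAdd x))) := fun x => rfl
  have hFs : Function.Surjective F := by
    intro y
    obtain ⟨p, hp⟩ := hφs (Multiplicative.ofAdd y)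
    have hp' : (p : X.PiC) ∈ H ⊔ X.DeltaX := by rw [hT.delta_sup]; exact p.2
    obtain ⟨h, hh, d, hd, hhd⟩ := Subgroup.mem_sup_of_normal_right.mp hp'
    refine ⟨Multiplicative.toAdd (e (QuotientGroup.mk ⟨d, hd⟩)), ?_⟩
    rw [hF, ofAdd_toAdd, MulEquiv.symm_apply_apply, hψ]
    have hhX : h ∈ X.PiX := hT.le hh
    have h1 : φ ⟨h, hhX⟩ = 1 := (hφk ⟨h, hhX⟩).mpr hh
    have hpd : p = ⟨h, hhX⟩ * ⟨d, hd.1⟩ := Subtype.ext hhd.symm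
    rw [hpd, map_mul, h1, one_mul] at hp
    change Multiplicative.toAdd (φ ⟨d, hd.1⟩) = y
    rw [hp, toAdd_ofAdd]
  obtain ⟨w, hw0, hwgen⟩ := zmod_ker_cyclic F hFs
  obtain ⟨g, hg⟩ := QuotientGroup.mk_surjective (e.symm (Multiplicative.ofAdd w))
  have hψg : ψ (QuotientGroup.mk g) = 1 := by
    have := hF w
    rw [hw0, ← hg] at this
    rw [← ofAdd_toAdd (ψ (QuotientGroup.mk g)), ← this, ofAdd_zero]
  have hgH : (g : X.PiC) ∈ H := by
    rw [← hφk ⟨g, g.2.1⟩, ← hψ]; exact hψg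
  refine ⟨g, hgH, g.2, fun d hdH hdΔ => ?_⟩
  have hd1 : ψ (QuotientGroup.mk ⟨d, hdΔ⟩) = 1 := by rw [hψ]; exact (hφk ⟨d, hdΔ.1⟩).mpr hdH
  have hFd : F (Multiplicative.toAdd (e (QuotientGroup.mk ⟨d, hdΔ⟩))) = 0 := by
    rw [hF, ofAdd_toAdd, MulEquiv.symm_apply_apply, hd1, toAdd_one]
  obtain ⟨n, hn⟩ := hwgen _ hFd
  have hnw : n • w = ((n.cast : ℤ)) • w := by
    rw [← Int.cast_smul_eq_zsmul (ZMod l), ZMod.intCast_zmod_cast]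
  have hmk : (QuotientGroup.mk ⟨d, hdΔ⟩ : X.DeltaX ⧸ X.barTheta.subgroupOf X.DeltaX) =
      QuotientGroup.mk (g ^ ((n.cast : ℤ))) := by
    rw [QuotientGroup.mk_zpow]
    apply e.injective
    rw [map_zpow, hg, MulEquiv.apply_symm_apply, ← ofAdd_zsmul, ← hnw, ← hn, ofAdd_toAdd]
  rw [QuotientGroup.eq, Subgroup.mem_subgroupOf] at hmk
  refine ⟨(n.cast : ℤ), ((g ^ ((n.cast : ℤ)) : X.DeltaX) : X.PiC)⁻¹ * d, ?_, ?_⟩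
  · have := X.barTheta.inv_mem hmk
    simpa [mul_inv_rev] using this
  · rw [Subgroup.coe_zpow, mul_inv_cancel_left]

/-! ## Step 2: `Δ_X̲/Ker` is abelian (bare interface) -/

/-- `Δ_X̲` is abelian modulo `Ker = Ker(Δ_X ↠ Δ̄_X)`, over the bare interface: it is cyclic modulo the
central `Δ̄_Θ`-preimage. [cite: MochizukiEtTh2009, Prop 2.2(i) p.37] -/
theorem comm_of_mem {H : Subgroup X.PiC} (hT : X.IsTypeLTors H) {a b : X.PiC}
    (haH : a ∈ H) (haΔ : a ∈ X.DeltaX) (hbH : b ∈ H) (hbΔ : b ∈ X.DeltaX) :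
    a * b * a⁻¹ * b⁻¹ ∈ X.barKer := by
  haveI := X.barKer_normal
  obtain ⟨g, -, hgΔ, hgen⟩ := X.exists_generator_mod_barTheta hT
  obtain ⟨i, t, ht, rfl⟩ := hgen a haH haΔ
  obtain ⟨j, t', ht', rfl⟩ := hgen b hbH hbΔ
  have hcen : ∀ s ∈ X.barTheta, ∀ x ∈ X.DeltaX,
      Commute ((s : X.PiC) : X.PiC ⧸ X.barKer) (x : X.PiC ⧸ X.barKer) := by
    intro s hs x hx
    have h1 : ((s * x * s⁻¹ * x⁻¹ : X.PiC) : X.PiC ⧸ X.barKer) = 1 :=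
      (QuotientGroup.eq_one_iff _).mpr (X.barTheta_central s hs x hx)
    simp only [QuotientGroup.mk_mul, QuotientGroup.mk_inv] at h1
    change (s : X.PiC ⧸ X.barKer) * x = x * s
    calc (s : X.PiC ⧸ X.barKer) * x = ((s : X.PiC ⧸ X.barKer) * x * (s : X.PiC ⧸ X.barKer)⁻¹ *
          (x : X.PiC ⧸ X.barKer)⁻¹) * (x * s) := by group
      _ = x * s := by rw [h1, one_mul]
  rw [← QuotientGroup.eq_one_iff]
  simp only [QuotientGroup.mk_mul, QuotientGroup.mk_inv, QuotientGroup.mk_zpow]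
  have h1 : Commute ((t : X.PiC) : X.PiC ⧸ X.barKer) (g : X.PiC ⧸ X.barKer) := hcen t ht g hgΔ
  have h2 : Commute ((t' : X.PiC) : X.PiC ⧸ X.barKer) (g : X.PiC ⧸ X.barKer) := hcen t' ht' g hgΔ
  have h3 : Commute ((t : X.PiC) : X.PiC ⧸ X.barKer) (t' : X.PiC ⧸ X.barKer) :=
    hcen t ht t' (X.barTheta_le ht')
  have key : Commute ((g : X.PiC ⧸ X.barKer) ^ i * (t : X.PiC ⧸ X.barKer))
      ((g : X.PiC ⧸ X.barKer) ^ j * (t' : X.PiC ⧸ X.barKer)) :=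
    Commute.mul_left (Commute.mul_right (Commute.zpow_zpow (Commute.refl _) i j)
      (h2.symm.zpow_left i)) (Commute.mul_right (h1.zpow_right j) h3)
  rw [key.eq]
  group

/-! ## Proposition 2.2 (i) for one datum, from the two eigenvalue hypotheses at that datum -/

/-- **Prop 2.2 (i) over the bare interface, for ONE datum `(Π_C̲ = H', ι̲)`**: if THIS inversion `ι̲` acts
by `−1` on `Δ̄^ell_X̲` (`hell`) and by `+1` on `Δ̄_Θ` (`htheta`) — "eigenvalues `−1` and `1`" — then the
`(−1)`-eigenspace datum `E = Im(s_ι)`-preimage EXISTS and is UNIQUE (abc-iut-L2-t10's proof, with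
`pow_mem_barKer` replaced by `[Δ̄_Θ-preimage : Ker] = l`). [cite: MochizukiEtTh2009, Prop 2.2(i) p.37] -/
theorem existsUnique_isMinusEigen_of_inversion {H H' : Subgroup X.PiC} {ι : X.PiC}
    (hH' : X.IsTypeLTorsPm H') (hH : H = H' ⊓ X.PiX) (hι : X.IsInversion H' ι)
    (hell : ∀ d ∈ H ⊓ X.DeltaC, ι * d * ι⁻¹ * d ∈ X.barTheta)
    (htheta : ∀ t ∈ X.barTheta, ι * t * ι⁻¹ * t⁻¹ ∈ X.barKer) :
    ∃! E : Subgroup X.PiC, X.IsMinusEigen H H' ι E := by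
  classical
  haveI := X.PiX_normal
  haveI := X.barTheta_normal
  haveI := X.barKer_normal
  have hT : X.IsTypeLTors H := by rw [hH]; exact hH'.inf_isTypeLTors
  obtain ⟨m, hm⟩ := X.l_odd
  have hKT : X.barKer ≤ X.barTheta := X.barKer_le_barTheta
  have hTΔ : X.barTheta ≤ X.DeltaX := X.barTheta_le
  have hHX : H ≤ X.PiX := hT.le
  have hTH : X.barTheta ≤ H := hT.barTheta_le
  have hDΔ : ∀ {d}, d ∈ H ⊓ X.DeltaC → d ∈ X.DeltaX := fun hd => ⟨hHX hd.1, hd.2⟩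
  have hTD : ∀ {t}, t ∈ X.barTheta → t ∈ H ⊓ X.DeltaC := fun ht => ⟨hTH ht, (hTΔ ht).2⟩
  have hιC : ι ∈ X.aug.ker := hι.mem_delta
  have hιX : ι ∉ X.PiX := hι.not_mem
  have hιH' : ι ∈ H' := hι.mem
  let π : X.PiC →* X.PiC ⧸ X.barKer := QuotientGroup.mk' X.barKer
  have hπ : ∀ x, π x = 1 ↔ x ∈ X.barKer := fun x => QuotientGroup.eq_one_iff x
  have hπ4 : ∀ a b c d : X.PiC, a * b * c⁻¹ * d ∈ X.barKer ↔ π a * π b * (π c)⁻¹ * π d = 1 := by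
    intro a b c d
    rw [← hπ, map_mul, map_mul, map_mul, map_inv]
  have hcomm4 : ∀ a b : X.PiC, a * b * a⁻¹ * b⁻¹ ∈ X.barKer → Commute (π a) (π b) := by
    intro a b h
    have h1 : π a * π b * (π a)⁻¹ * π b⁻¹ = 1 := (hπ4 a b a b⁻¹).mp h
    rw [map_inv] at h1
    change π a * π b = π b * π a
    calc π a * π b = (π a * π b * (π a)⁻¹ * (π b)⁻¹) * (π b * π a) := by group
      _ = π b * π a := by rw [h1, one_mul]
  have hcen : ∀ t ∈ X.barTheta, ∀ x ∈ X.DeltaX, Commute (π t) (π x) :=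
    fun t ht x hx => hcomm4 t x (X.barTheta_central t ht x hx)
  have hplus : ∀ t ∈ X.barTheta, Commute (π ι) (π t) := fun t ht => hcomm4 ι t (htheta t ht)
  have hcomm : ∀ a ∈ H ⊓ X.DeltaC, ∀ b ∈ H ⊓ X.DeltaC, Commute (π a) (π b) :=
    fun a ha b hb => hcomm4 a b (X.comm_of_mem hT ha.1 (hDΔ ha) hb.1 (hDΔ hb))
  have hιD : ∀ d ∈ H ⊓ X.DeltaC, ι * d * ι⁻¹ ∈ H ⊓ X.DeltaC := by
    intro d hd
    have hdH' : d ∈ H' := by rw [hH] at hd; exact hd.1.1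
    refine ⟨?_, (MonoidHom.normal_ker X.aug).conj_mem _ hd.2 ι⟩
    rw [hH]
    exact ⟨H'.mul_mem (H'.mul_mem hιH' hdH') (H'.inv_mem hιH'), X.PiX_normal.conj_mem _ (hHX hd.1) ι⟩
  have hgD : ∀ g ∈ H, ∀ d ∈ H ⊓ X.DeltaC, g * d * g⁻¹ ∈ H ⊓ X.DeltaC := fun g hg d hd =>
    ⟨H.mul_mem (H.mul_mem hg hd.1) (H.inv_mem hg), (MonoidHom.normal_ker X.aug).conj_mem _ hd.2 g⟩
  have hgι : ∀ g ∈ H, g * ι * g⁻¹ * ι⁻¹ ∈ H ⊓ X.DeltaC := by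
    intro g hg
    have hgH' : g ∈ H' := by rw [hH] at hg; exact hg.1
    refine ⟨?_, ?_⟩
    · rw [hH]
      refine ⟨H'.mul_mem (H'.mul_mem (H'.mul_mem hgH' hιH') (H'.inv_mem hgH')) (H'.inv_mem hιH'), ?_⟩
      have h1 : g * ι * g⁻¹ ∉ X.PiX := fun h1 =>
        hιX (by simpa [mul_assoc] using X.PiX_normal.conj_mem _ h1 g⁻¹)
      exact (Subgroup.mul_mem_iff_of_index_two X.index_PiX).mpr
        ⟨fun h => absurd h h1, fun h => absurd (inv_mem_iff.mp h) hιX⟩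
    · change X.aug (g * ι * g⁻¹ * ι⁻¹) = 1
      rw [map_mul, map_mul, map_mul, map_inv, map_inv, (MonoidHom.mem_ker).mp hιC]
      simp
  have hminus_iff : ∀ d, ι * d * ι⁻¹ * d ∈ X.barKer ↔ π ι * π d * (π ι)⁻¹ = (π d)⁻¹ := by
    intro d
    rw [hπ4, mul_eq_one_iff_eq_inv]
  -- the eigenspace
  let E : Subgroup X.PiC :=
    { carrier := {d | d ∈ H ⊓ X.DeltaC ∧ ι * d * ι⁻¹ * d ∈ X.barKer}
      mul_mem' := by
        rintro a b ⟨ha, ha'⟩ ⟨hb, hb'⟩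
        refine ⟨Subgroup.mul_mem _ ha hb, ?_⟩
        rw [hminus_iff] at ha' hb' ⊢
        rw [map_mul]
        calc π ι * (π a * π b) * (π ι)⁻¹ = (π ι * π a * (π ι)⁻¹) * (π ι * π b * (π ι)⁻¹) := by group
          _ = (π a)⁻¹ * (π b)⁻¹ := by rw [ha', hb']
          _ = (π b * π a)⁻¹ := by rw [mul_inv_rev]
          _ = (π a * π b)⁻¹ := by rw [(hcomm a ha b hb).eq]
      one_mem' := ⟨Subgroup.one_mem _, by simp⟩
      inv_mem' := by
        rintro a ⟨ha, ha'⟩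
        refine ⟨Subgroup.inv_mem _ ha, ?_⟩
        rw [hminus_iff] at ha' ⊢
        rw [map_inv]
        calc π ι * (π a)⁻¹ * (π ι)⁻¹ = (π ι * π a * (π ι)⁻¹)⁻¹ := by group
          _ = ((π a)⁻¹)⁻¹ := by rw [ha'] }
  have hE_mem : ∀ {d}, d ∈ E ↔ d ∈ H ⊓ X.DeltaC ∧ ι * d * ι⁻¹ * d ∈ X.barKer := Iff.rfl
  have hKE : X.barKer ≤ E := fun k hk =>
    hE_mem.mpr ⟨hTD (hKT hk), X.barKer.mul_mem (X.barKer_normal.conj_mem _ hk ι) hk⟩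
  have hinf : E ⊓ X.barTheta = X.barKer := by
    refine le_antisymm ?_ (le_inf hKE hKT)
    rintro e ⟨he, heT⟩
    obtain ⟨-, he2⟩ := hE_mem.mp he
    refine X.mem_barKer_of_sq_mem_of_mem_barTheta heT ?_
    rw [← hπ, map_mul]
    have h1 := (hminus_iff e).mp he2
    rw [(hplus e heT).eq, mul_inv_cancel_right] at h1
    nth_rw 1 [h1]
    exact inv_mul_cancel _
  -- every `d ∈ Δ_X̲` splits as `e · t` with `t = s^{(l+1)/2}`, `s = ι d ι⁻¹ d`
  have hsplit : ∀ d ∈ H ⊓ X.DeltaC, ∃ e ∈ E, ∃ t ∈ X.barTheta, d = e * t := by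
    intro d hd
    have hs : ι * d * ι⁻¹ * d ∈ X.barTheta := hell d hd
    set s := ι * d * ι⁻¹ * d with hs_def
    refine ⟨d * (s ^ (m + 1))⁻¹, ?_, s ^ (m + 1), X.barTheta.pow_mem hs _, by group⟩
    refine hE_mem.mpr
      ⟨Subgroup.mul_mem _ hd (Subgroup.inv_mem _ (hTD (X.barTheta.pow_mem hs _))), ?_⟩
    rw [hminus_iff, map_mul, map_inv, map_pow]
    have hIS : Commute (π ι) (π s) := hplus s hs
    have hSD : Commute (π s) (π d) := hcen s hs d (hDΔ hd)
    have hSl : π s ^ l = 1 := by rw [← map_pow, hπ]; exact X.pow_mem_barKer_of_mem_barTheta hs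
    have hS : π ι * π d * (π ι)⁻¹ * π d = π s := by
      rw [hs_def, map_mul, map_mul, map_mul, map_inv]
    have hS' : π ι * π d * (π ι)⁻¹ = π s * (π d)⁻¹ := by
      rw [← hS, mul_inv_cancel_right]
    have hIT : Commute (π ι) ((π s ^ (m + 1))⁻¹) := (hIS.pow_right (m + 1)).inv_right
    have hTDc : Commute ((π s ^ (m + 1))⁻¹) ((π d)⁻¹) := (hSD.pow_left (m + 1)).inv_inv
    have hT2 : π s ^ (m + 1) * π s ^ (m + 1) = π s := by
      rw [← pow_add, show m + 1 + (m + 1) = l + 1 by omega, pow_succ, hSl, one_mul]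
    calc π ι * (π d * (π s ^ (m + 1))⁻¹) * (π ι)⁻¹
        = (π ι * π d * (π ι)⁻¹) * (π ι * (π s ^ (m + 1))⁻¹ * (π ι)⁻¹) := by group
      _ = (π s * (π d)⁻¹) * (π s ^ (m + 1))⁻¹ := by rw [hS', hIT.eq, mul_inv_cancel_right]
      _ = π s * ((π s ^ (m + 1))⁻¹ * (π d)⁻¹) := by rw [mul_assoc, ← hTDc.eq]
      _ = (π s ^ (m + 1) * π s ^ (m + 1)) * ((π s ^ (m + 1))⁻¹ * (π d)⁻¹) := by rw [hT2]
      _ = (π d * (π s ^ (m + 1))⁻¹)⁻¹ := by group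
  have hsup : E ⊔ X.barTheta = H ⊓ X.DeltaC := by
    refine le_antisymm (sup_le (fun e he => (hE_mem.mp he).1) (fun t ht => hTD ht)) ?_
    intro d hd
    obtain ⟨e, he, t, ht, rfl⟩ := hsplit d hd
    exact Subgroup.mul_mem_sup he ht
  refine ⟨E,
    { barKer_le := hKE
      le := fun e he => (hE_mem.mp he).1
      conj_mem := ?_
      inf_eq := hinf
      sup_eq := hsup
      minus := fun e he => (hE_mem.mp he).2
      plus := htheta
      iota_conj := ?_ }, ?_⟩
  · intro g hg e he'
    obtain ⟨he1, he2'⟩ := hE_mem.mp he'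
    refine hE_mem.mpr ⟨hgD g hg e he1, ?_⟩
    have he2 := (hminus_iff e).mp he2'
    have hX : Commute (π (g * ι * g⁻¹ * ι⁻¹)) (π (g * e⁻¹ * g⁻¹)) :=
      hcomm _ (hgι g hg) _ (hgD g hg e⁻¹ (Subgroup.inv_mem _ he1))
    simp only [map_mul, map_inv] at hX
    rw [hminus_iff, map_mul, map_mul, map_inv]
    set I := π ι
    set G := π g
    set Ee := π e
    set C := G * I * G⁻¹ * I⁻¹ with hC
    calc I * (G * Ee * G⁻¹) * I⁻¹ = C⁻¹ * G * (I * Ee * I⁻¹) * G⁻¹ * C := by rw [hC]; group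
      _ = C⁻¹ * (G * Ee⁻¹ * G⁻¹) * C := by rw [he2]; group
      _ = C⁻¹ * (C * (G * Ee⁻¹ * G⁻¹)) := by rw [mul_assoc C⁻¹ (G * Ee⁻¹ * G⁻¹) C, ← hX.eq]
      _ = (G * Ee * G⁻¹)⁻¹ := by group
  · intro e he'
    obtain ⟨he1, he2'⟩ := hE_mem.mp he'
    refine hE_mem.mpr ⟨hιD e he1, ?_⟩
    have he2 := (hminus_iff e).mp he2'
    rw [hminus_iff, map_mul, map_mul, map_inv, he2]
    calc π ι * (π e)⁻¹ * (π ι)⁻¹ = (π ι * π e * (π ι)⁻¹)⁻¹ := by group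
      _ = ((π e)⁻¹)⁻¹ := by rw [he2]
  · intro E' hE'
    refine le_antisymm (fun x hx => hE_mem.mpr ⟨hE'.le hx, hE'.minus x hx⟩) (fun x hx => ?_)
    have hxD : x ∈ H ⊓ X.DeltaC := (hE_mem.mp hx).1
    have hx' : x ∈ E' ⊔ X.barTheta := by rw [hE'.sup_eq]; exact hxD
    obtain ⟨y, hy, z, hz, hyz⟩ := Subgroup.mem_sup_of_normal_right.mp hx'
    subst hyz
    have hyD : y ∈ H ⊓ X.DeltaC := hE'.le hy
    have hy2 := (hminus_iff y).mp (hE'.minus y hy)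
    have hx2 := (hminus_iff (y * z)).mp (hE_mem.mp hx).2
    rw [map_mul] at hx2
    have hIZ : Commute (π ι) (π z) := hplus z hz
    have hYZ : Commute (π y) (π z) := hcomm y hyD z (hTD hz)
    have h1 : (π y)⁻¹ * π z = (π z)⁻¹ * (π y)⁻¹ := by
      calc (π y)⁻¹ * π z = (π ι * π y * (π ι)⁻¹) * (π ι * π z * (π ι)⁻¹) := by
            rw [hy2, hIZ.eq, mul_inv_cancel_right]
        _ = π ι * (π y * π z) * (π ι)⁻¹ := by group
        _ = (π y * π z)⁻¹ := hx2
        _ = (π z)⁻¹ * (π y)⁻¹ := mul_inv_rev _ _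
    have h2 : π z = (π z)⁻¹ := by
      rw [← hYZ.inv_inv.eq] at h1
      exact mul_left_cancel h1
    have hzK : z ∈ X.barKer := by
      refine X.mem_barKer_of_sq_mem_of_mem_barTheta hz ?_
      rw [← hπ, map_mul]
      nth_rw 1 [h2]
      exact inv_mul_cancel _
    exact E'.mul_mem hy (hE'.barKer_le hzK)

/-- **[EtTh] Proposition 2.2 (i) over the bare interface from the two inversion axioms ALONE**
(`inv_ell`: elements of `Δ_C ∖ Δ_X` act by `−1` on `Δ̄^ell_X`; `inv_theta`: by `+1` on `Δ̄_Θ`): the named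
fact `CoverData.Prop22_i` holds — `CoverDataAx.prop22_i_holds` is the special case, and the third
`CoverDataAx` axiom `pow_mem_barKer` is idle for it. [cite: MochizukiEtTh2009, Prop 2.2(i) p.37] -/
theorem prop22_i_of_inv
    (hell : ∀ c ∈ X.DeltaC, c ∉ X.PiX → ∀ d ∈ X.DeltaX, c * d * c⁻¹ * d ∈ X.barTheta)
    (htheta : ∀ c ∈ X.DeltaC, c ∉ X.PiX → ∀ t ∈ X.barTheta, c * t * c⁻¹ * t⁻¹ ∈ X.barKer) :
    Literature.AnabelianGeometry.EtaleTheta.ThetaCovers.CoverData.Prop22_i X := by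
  intro H H' ι hH' hH hι
  have hT : X.IsTypeLTors H := by rw [hH]; exact hH'.inf_isTypeLTors
  exact X.existsUnique_isMinusEigen_of_inversion hH' hH hι
    (fun d hd => hell ι hι.mem_delta hι.not_mem d ⟨hT.le hd.1, hd.2⟩)
    (htheta ι hι.mem_delta hι.not_mem)

end Literature.AnabelianGeometry.EtaleTheta.ThetaCovers.CoverData
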